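import Summits.Parity.GeneralizedHardyLittlewood.Theorems.LeeYangFibresRelativeDimOneSingularMeanGlueAux
import Summits.Parity.GeneralizedHardyLittlewood.Theorems.LeeYangFibresRelativeDimOneSingularMeanGlueAux2
import HarnessLib

/-!
# Route `LeeYangFibres`, crux `RelativeDimOne` (stmt-Parity-14113), line `SketchIdeator1` =
`translate-amplification`: the registered stub `stub_singularMeanGlue` (B2, Gallagher averaging)

We prove `SingularMeanGlue : LocalAverage → SingularTail → DegenerateCount → ArchFacts → SingularMean`
(vocabulary file `LeeYangFibresRelativeDimOneDefs.lean`): the main terms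
`M_H = β_∞(Ψ^{(H)}, K_H) 𝔖(Ψ^{(H)})` of the non-degenerate translate-constellations sum to
`(β_∞(Ψ,K) 𝔖(Ψ))^{m+1}` up to `ε ((β_∞ 𝔖)^{m+1} + N^{m+1})`.

Proof (Gallagher's interchange argument). Put `y = y_N = ⌊log N/4⌋`, `P = ∏_{p ≤ y} p ≤ 4^y ≤ N^{(log 4)/4}`,
`I = K ∩ {Ψ > 0}`, `w(H) = vol(I_H) = β_∞(Ψ^{(H)}, K_H)` (`archFactor_translateFamily`),
`F(H) = ∏_{p ≤ y} β_p(Ψ^{(H)}) ≤ y^T`, `F₀ = ∏_{p ≤ y} β_p(Ψ)`, `T = (m+1)t`.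
* tails (`SingularTail` at `(T, (3m+1)L, δ)` and `(t, L, δ)`, sizes by `affLinSize_translateFamily_le`):
  `|𝔖(Ψ^{(H)}) − F(H)| ≤ δ F(H)` for non-degenerate `H`, `|𝔖(Ψ) − F₀| ≤ δ F₀`;
* cubes: `w` vanishes off the shift box, which is covered by the `(2R+1)^m` disjoint cubes
  `cP + [0,P)^m`, `c ∈ [-R,R]^m`, `R = ⌊2N/P⌋ + 1`; on a cube `w` varies by `≤ 2mP` (`ArchFacts`, Lipschitz)
  and `∑_{cube} F = P^m F₀^{m+1}` (`LocalAverage`), so `|∑_{box} wF − F₀^{m+1} ∑_{box} w| ≤ (7N)^m 4mP F₀^{m+1}`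
  (`shiftBox_sum_mul_sub_le`), while `|∑_{box} w − vol(I)^{m+1}| ≤ C (N+1)^m` (`ArchFacts`);
* degenerate shifts: `≤ C (4N+1)^{m-1}` of them (`DegenerateCount`; none for `m = 0`), each of weight
  `≤ 2N y^T`;
* bookkeeping (`glue_algebra`): relative error `4(m+1)δ ≤ ε`, absolute error
  `≪ y^T P N^m ≤ ε N^{m+1}` by `primorial_mul_pow_truncLevel_eventually_le` (`log^T N · N^{0.35} = o(N)`).

References: P. X. Gallagher, Mathematika 23 (1976), §2 [Gallagher1976]; B. Green, T. Tao, Ann. of Math. 171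
(2010), (1.4)–(1.7), Lemma 1.3 [GreenTao2010].
-/

noncomputable section

open scoped BigOperators Classical Topology
open Finset Filter MeasureTheory Literature.NumberTheory.Sieve

namespace Summit.Parity.GeneralizedHardyLittlewood.Cruxes.RelativeDimOne.TranslateAmplification

open CellParityLaw.SectionAnnihilator.SingularRatio (singularProduct_nonneg singularProductPartial_nonneg)

/-- **`stub_singularMeanGlue`** (registered stub of the line `SketchIdeator1`): Gallagher's interchange
argument. Cover the shift box by cubes of side `P = ∏_{p ≤ y_N} p ≤ N^{0.35}`; on a cube the
archimedean weight `w(H) = β_∞(Ψ^{(H)}, K_H)` is constant up to `2 m P` (`ArchFacts`) and the truncated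
singular products average exactly (`LocalAverage`); the tails `𝔖 = (1 + O(δ))∏_{p ≤ y_N} β_p` are uniform
(`SingularTail`); degenerate shifts are few (`DegenerateCount`) and cost `O(N^m log^T N)` by the crude
bound `∏_{p ≤ y} β_p ≤ y^T`. -/
theorem stub_singularMeanGlue : SingularMeanGlue := by
  intro hA hT hD hF m t L _ht ε hε
  -- the constants of the hypotheses
  obtain ⟨C_D, hCD⟩ := hD m t
  obtain ⟨C_F, hCF⟩ := hF m
  set CD : ℝ := max C_D 0 with hCDdef
  set CF : ℝ := max C_F 0 with hCFdef
  have hCD0 : 0 ≤ CD := le_max_right _ _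
  have hCF0 : 0 ≤ CF := le_max_right _ _
  have hm0 : (0 : ℝ) ≤ m := Nat.cast_nonneg m
  have hm1 : (0 : ℝ) < m + 1 := by positivity
  -- the relative error parameter `δ` and the tail thresholds
  set δ : ℝ := min (ε / (4 * (m + 1))) (1 / (2 * (m + 1))) with hδdef
  have hδ0 : 0 < δ := lt_min (by positivity) (by positivity)
  have hδε : 4 * (m + 1) * δ ≤ ε := by
    have h := min_le_left (ε / (4 * (m + 1))) (1 / (2 * (m + 1)))
    rw [← hδdef, le_div_iff₀ (by positivity)] at h
    linarith
  have hδ1 : 2 * (m + 1) * δ ≤ 1 := by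
    have h := min_le_right (ε / (4 * (m + 1))) (1 / (2 * (m + 1)))
    rw [← hδdef, le_div_iff₀ (by positivity)] at h
    linarith
  obtain ⟨N₁, hN₁⟩ := hT ((m + 1) * t) ((3 * m + 1) * L) δ hδ0
  obtain ⟨N₂, hN₂⟩ := hT t L δ hδ0
  -- the absolute error constant and the size threshold
  set Cst : ℝ := 2 ^ m * CF + 4 * m * 7 ^ m + 5 ^ m * CD with hCstdef
  have hCst0 : 0 ≤ Cst := by positivity
  set η : ℝ := ε / (2 * (Cst + 1)) with hηdef
  have hη0 : 0 < η := by positivity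
  have hηε : 2 * Cst * η ≤ ε := by
    rw [hηdef, mul_div_assoc', div_le_iff₀ (by positivity)]
    nlinarith
  have hev : ∀ᶠ N : ℕ in atTop, N₁ ≤ N ∧ N₂ ≤ N ∧ Real.exp 4 ≤ (N : ℝ) ∧
      ((primorial (truncLevel N) : ℕ) : ℝ) * (truncLevel N : ℝ) ^ ((m + 1) * t) ≤ η * N ∧
      ((primorial (truncLevel N) : ℕ) : ℝ) * (truncLevel N : ℝ) ^ 0 ≤ 1 * N := by
    filter_upwards [eventually_ge_atTop N₁, eventually_ge_atTop N₂,
      tendsto_natCast_atTop_atTop.eventually (eventually_ge_atTop (Real.exp 4)),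
      primorial_mul_pow_truncLevel_eventually_le ((m + 1) * t) hη0,
      primorial_mul_pow_truncLevel_eventually_le 0 one_pos] with N h1 h2 h3 h4 h5
    exact ⟨h1, h2, h3, h4, h5⟩
  obtain ⟨N₀, hN₀⟩ := Filter.eventually_atTop.mp hev
  refine ⟨N₀, fun N hN Ψ hΨ hL K hK hKN => ?_⟩
  obtain ⟨hNN₁, hNN₂, hN4, hkey, hPN⟩ := hN₀ N hN
  -- basic quantities at `N`
  have hN1 : 1 ≤ N := by
    have : (1 : ℝ) ≤ N := le_trans (by linarith [Real.add_one_le_exp (4 : ℝ)]) hN4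
    exact_mod_cast this
  have hN1r : (1 : ℝ) ≤ N := by exact_mod_cast hN1
  set y : ℕ := truncLevel N with hydef
  have hy1 : 1 ≤ y := one_le_truncLevel hN4
  set P : ℕ := primorial y with hPdef
  have hP0 : 0 < P := primorial_pos y
  have hP1r : (1 : ℝ) ≤ P := by exact_mod_cast hP0
  have hPN' : (P : ℝ) ≤ N := by simpa using hPN
  have hPNn : P ≤ N := by exact_mod_cast hPN'
  set R : ℕ := 2 * N / P + 1 with hRdef
  have hR : 2 * N < R * P := by
    rw [hRdef, Nat.add_mul, one_mul]
    exact Nat.lt_div_mul_add hP0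
  have hRP : ((2 * R + 1 : ℕ) : ℝ) * P ≤ 7 * N := by
    have h : (2 * R + 1) * P ≤ 7 * N := by
      have := Nat.div_mul_le_self (2 * N) P
      rw [hRdef]
      nlinarith
    exact_mod_cast h
  set Y : ℝ := (y : ℝ) ^ ((m + 1) * t) with hYdef
  have hY0 : 0 ≤ Y := by positivity
  -- the positivity region `I = K ∩ {Ψ > 0}` and the weights
  set I : Set (Fin 1 → ℝ) := posBody Ψ 0 K with hIdef
  have hIc : Convex ℝ I := convex_posBody Ψ 0 hK
  have hIN : I ⊆ realBox 1 N := (posBody_subset Ψ 0 K).trans hKN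
  set w : (Fin m → ℤ) → ℝ := fun H => (volume (meetTranslates I H)).toReal with hwdef
  set Fn : (Fin m → ℤ) → ℝ := fun H => singularProductPartial (translateFamily Ψ H) y with hFndef
  set F₀ : ℝ := singularProductPartial Ψ y with hF₀def
  set V : ℝ := (volume I).toReal with hVdef
  obtain ⟨hsumw, hlip⟩ := hCF N I hIc hIN
  have hVb := toReal_volume_le_of_subset_realBox hIN
  have hV0 : 0 ≤ V := ENNReal.toReal_nonneg
  have hw0 : ∀ H, H ∉ shiftBox m N → w H = 0 := fun H hH =>
    toReal_volume_meetTranslates_eq_zero hIN hH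
  have hwb : ∀ H, 0 ≤ w H ∧ w H ≤ 2 * N := fun H =>
    ⟨ENNReal.toReal_nonneg, (toReal_volume_meetTranslates_le hIN H).trans hVb.1⟩
  have hFnb : ∀ H, 0 ≤ Fn H ∧ Fn H ≤ Y := fun H =>
    ⟨singularProductPartial_nonneg _ _, singularProductPartial_le_pow _ hy1⟩
  have hF₀0 : 0 ≤ F₀ := singularProductPartial_nonneg _ _
  have hF₀Y : F₀ ^ (m + 1) ≤ Y := by
    calc F₀ ^ (m + 1) ≤ ((y : ℝ) ^ t) ^ (m + 1) :=
          pow_le_pow_left₀ hF₀0 (singularProductPartial_le_pow Ψ hy1) _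
      _ = Y := by rw [← pow_mul, mul_comm]
  -- the target in terms of `w`
  have harch : ∀ H, archFactor (translateFamily Ψ H) (meetTranslates K H) = w H := fun H =>
    archFactor_translateFamily Ψ K H
  have hV' : archFactor Ψ K = V := archFactor_eq_volume_posBody Ψ K
  simp only [harch, hV']
  set G := (shiftBox m N).filter (fun H => IsNondegenerateSystem (translateFamily Ψ H)) with hGdef
  have hGsub : G ⊆ shiftBox m N := Finset.filter_subset _ _
  -- tails
  have htail : ∀ H ∈ G, |singularProduct (translateFamily Ψ H) - Fn H| ≤ δ * Fn H := by
    intro H hH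
    obtain ⟨hHbox, hHnd⟩ := Finset.mem_filter.mp hH
    have hsize : affLinSize (translateFamily Ψ H) N ≤ ((3 * m + 1) * L : ℕ) := by
      have := affLinSize_translateFamily_le hN1 hL hHbox
      push_cast
      exact this
    exact hN₁ N hNN₁ (translateFamily Ψ H) hHnd hsize
  have htail0 : |singularProduct Ψ - F₀| ≤ δ * F₀ := hN₂ N hNN₂ Ψ hΨ hL
  -- `A` (the target sum), `B` (its truncation), the full sums and the degenerate part
  set A : ℝ := ∑ H ∈ G, w H * singularProduct (translateFamily Ψ H) with hAdef
  set B : ℝ := ∑ H ∈ G, w H * Fn H with hBdef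
  set Sbox : ℝ := ∑ H ∈ shiftBox m N, w H * Fn H with hSboxdef
  set Wbox : ℝ := ∑ H ∈ shiftBox m N, w H with hWboxdef
  set DD : ℝ := ∑ H ∈ shiftBox m N \ G, w H * Fn H with hDDdef
  have h1 : |A - B| ≤ δ * B := by
    rw [hAdef, hBdef, ← Finset.sum_sub_distrib, Finset.mul_sum]
    calc |∑ H ∈ G, (w H * singularProduct (translateFamily Ψ H) - w H * Fn H)|
        ≤ ∑ H ∈ G, |w H * singularProduct (translateFamily Ψ H) - w H * Fn H| :=
          Finset.abs_sum_le_sum_abs _ _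
      _ ≤ ∑ H ∈ G, δ * (w H * Fn H) := Finset.sum_le_sum fun H hH => by
          rw [← mul_sub, abs_mul, abs_of_nonneg (hwb H).1]
          calc w H * |singularProduct (translateFamily Ψ H) - Fn H| ≤ w H * (δ * Fn H) :=
                mul_le_mul_of_nonneg_left (htail H hH) (hwb H).1
            _ = δ * (w H * Fn H) := by ring
  have hB : B = Sbox - DD := by
    have := Finset.sum_sdiff hGsub (f := fun H => w H * Fn H)
    rw [hBdef, hSboxdef, hDDdef]
    linarith
  -- cubes
  have h2 : |Sbox - F₀ ^ (m + 1) * Wbox| ≤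
      (2 * R + 1) ^ m * (4 * m * P * ((P : ℝ) ^ m * F₀ ^ (m + 1))) :=
    shiftBox_sum_mul_sub_le hP0 hR w Fn (F₀ ^ (m + 1)) (fun H => (hFnb H).1) (pow_nonneg hF₀0 _)
      hlip hw0 (fun a => localAverage_primorial hA m Ψ y a)
  -- archimedean sums
  have h3 : |Wbox - V ^ (m + 1)| ≤ CF * ((N : ℝ) + 1) ^ m :=
    hsumw.trans (mul_le_mul_of_nonneg_right (le_max_left _ _) (by positivity))
  -- degenerate shifts
  have h4 : 0 ≤ DD ∧ DD ≤ CD * 5 ^ m * (N : ℝ) ^ m * Y := by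
    obtain ⟨h0, hle⟩ := sum_mul_le_card_mul (shiftBox m N \ G) w Fn hwb hFnb
    refine ⟨h0, hle.trans ?_⟩
    have hsub : shiftBox m N \ G ⊆
        (shiftBox m N).filter (fun H => ¬ IsNondegenerateSystem (translateFamily Ψ H)) := by
      intro H hH
      rw [Finset.mem_sdiff] at hH
      refine Finset.mem_filter.mpr ⟨hH.1, fun hnd => hH.2 ?_⟩
      exact Finset.mem_filter.mpr ⟨hH.1, hnd⟩
    have hcard : (#(shiftBox m N \ G) : ℝ) ≤
        #((shiftBox m N).filter (fun H => ¬ IsNondegenerateSystem (translateFamily Ψ H))) := by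
      exact_mod_cast Finset.card_le_card hsub
    rcases Nat.eq_zero_or_pos m with hm | hm
    · rw [filter_not_nondegenerate_eq_empty hΨ N hm, Finset.card_empty, Nat.cast_zero] at hcard
      have : (#(shiftBox m N \ G) : ℝ) * (2 * N * Y) ≤ 0 := by
        have hc0 : (#(shiftBox m N \ G) : ℝ) = 0 := le_antisymm hcard (Nat.cast_nonneg _)
        rw [hc0, zero_mul]
      refine this.trans ?_
      positivity
    · have hc := hcard.trans ((hCD N Ψ hΨ).trans
        (mul_le_mul_of_nonneg_right (le_max_left C_D 0) (by positivity)))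
      calc (#(shiftBox m N \ G) : ℝ) * (2 * N * Y)
          ≤ CD * ((4 * N + 1 : ℕ) : ℝ) ^ (m - 1) * (2 * N * Y) :=
            mul_le_mul_of_nonneg_right hc (by positivity)
        _ = CD * (((4 * N + 1 : ℕ) : ℝ) ^ (m - 1) * (2 * N)) * Y := by ring
        _ ≤ CD * (5 ^ m * (N : ℝ) ^ m) * Y :=
            mul_le_mul_of_nonneg_right (mul_le_mul_of_nonneg_left (pow_pred_mul_le hm hN1) hCD0) hY0
        _ = CD * 5 ^ m * (N : ℝ) ^ m * Y := by ring
  -- the bookkeeping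
  have hmain := glue_algebra hB h1 h2 h3 h4 htail0 hF₀0 hV0 hδ0.le hδ1 hF₀Y
  -- the absolute errors are `≤ Cst · (P y^T) · N^m ≤ Cst η N^{m+1}`
  have hNm : 0 ≤ (N : ℝ) ^ m := by positivity
  have hPY : (P : ℝ) * Y ≤ η * N := hkey
  have hE3 : Y * (CF * ((N : ℝ) + 1) ^ m) ≤ 2 ^ m * CF * ((P : ℝ) * Y) * (N : ℝ) ^ m := by
    have h2N : ((N : ℝ) + 1) ^ m ≤ (2 * (N : ℝ)) ^ m :=
      pow_le_pow_left₀ (by positivity) (by linarith) m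
    calc Y * (CF * ((N : ℝ) + 1) ^ m) ≤ Y * (CF * (2 * (N : ℝ)) ^ m) := by gcongr
      _ = 2 ^ m * CF * (1 * Y) * (N : ℝ) ^ m := by rw [mul_pow]; ring
      _ ≤ 2 ^ m * CF * ((P : ℝ) * Y) * (N : ℝ) ^ m := by gcongr
  have hE1 : (2 * R + 1 : ℝ) ^ m * (4 * m * P * ((P : ℝ) ^ m * F₀ ^ (m + 1))) ≤
      4 * m * 7 ^ m * ((P : ℝ) * Y) * (N : ℝ) ^ m := by
    have h7 : ((2 * R + 1 : ℝ) * P) ^ m ≤ (7 * (N : ℝ)) ^ m := by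
      refine pow_le_pow_left₀ (by positivity) ?_ m
      exact_mod_cast hRP
    calc (2 * R + 1 : ℝ) ^ m * (4 * m * P * ((P : ℝ) ^ m * F₀ ^ (m + 1)))
        = 4 * m * P * ((2 * R + 1 : ℝ) * P) ^ m * F₀ ^ (m + 1) := by rw [mul_pow]; ring
      _ ≤ 4 * m * P * (7 * (N : ℝ)) ^ m * Y := by gcongr
      _ = 4 * m * 7 ^ m * ((P : ℝ) * Y) * (N : ℝ) ^ m := by rw [mul_pow]; ring
  have hE4 : CD * 5 ^ m * (N : ℝ) ^ m * Y ≤ 5 ^ m * CD * ((P : ℝ) * Y) * (N : ℝ) ^ m := by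
    calc CD * 5 ^ m * (N : ℝ) ^ m * Y = 5 ^ m * CD * (1 * Y) * (N : ℝ) ^ m := by ring
      _ ≤ 5 ^ m * CD * ((P : ℝ) * Y) * (N : ℝ) ^ m := by gcongr
  have hEabs : Y * (CF * ((N : ℝ) + 1) ^ m) +
      (2 * R + 1 : ℝ) ^ m * (4 * m * P * ((P : ℝ) ^ m * F₀ ^ (m + 1))) +
      CD * 5 ^ m * (N : ℝ) ^ m * Y ≤ Cst * (η * N) * (N : ℝ) ^ m := by
    calc _ ≤ 2 ^ m * CF * ((P : ℝ) * Y) * (N : ℝ) ^ m + 4 * m * 7 ^ m * ((P : ℝ) * Y) * (N : ℝ) ^ m +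
          5 ^ m * CD * ((P : ℝ) * Y) * (N : ℝ) ^ m := add_le_add (add_le_add hE3 hE1) hE4
      _ = Cst * ((P : ℝ) * Y) * (N : ℝ) ^ m := by rw [hCstdef]; ring
      _ ≤ Cst * (η * N) * (N : ℝ) ^ m := by gcongr
  have hS0 : 0 ≤ singularProduct Ψ := singularProduct_nonneg hΨ
  have hM0 : 0 ≤ (V * singularProduct Ψ) ^ (m + 1) := by positivity
  have hrel : 4 * (m + 1) * δ * (V * singularProduct Ψ) ^ (m + 1) ≤
      ε * (V * singularProduct Ψ) ^ (m + 1) := mul_le_mul_of_nonneg_right hδε hM0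
  have habs : 2 * (Cst * (η * N) * (N : ℝ) ^ m) ≤ ε * (N : ℝ) ^ (m + 1) := by
    rw [pow_succ]
    have : 2 * (Cst * (η * N) * (N : ℝ) ^ m) = (2 * Cst * η) * ((N : ℝ) ^ m * N) := by ring
    rw [this]
    exact mul_le_mul_of_nonneg_right hηε (by positivity)
  refine hmain.trans ?_
  linarith [hEabs, hrel, habs]

end Summit.Parity.GeneralizedHardyLittlewood.Cruxes.RelativeDimOne.TranslateAmplification
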